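import Mathlib

/-!
# Route GeneratorObstructions — crux K2 `PowGenDegreeQP` (stmt-ValiantsHypothesis-11655), line
# `trace-side-regimes`: Fubini over a partition of the index set (tool for the last regrouping step)

Generic tool for step (R3) of the last remaining certificate theorem (`gadgetTab_fiberSum_eq_pow`, see
the skeleton attached to the item): a sum over tuples `ρ : Π p, A p` of a product over the classes
`γ` of a partition `g : P → Γ` of factors depending only on the restriction of `ρ` to the class
factorises as the product over `γ` of the sums over restricted tuples (`sum_pi_prod_fiberwise`), via
the restriction equivalence `piFiberwiseEquiv : (Π p, A p) ≃ Π γ, Π p : {p // g p = γ}, A p`.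
Intended use: `P` = (column, block) pairs of the gadget tableau, `Γ` = (block, copy) groups plus one
class of empty fibres, `A p` = permutations of the fibre; the per-group sums are `blockSum k`.

Honest framing: elementary; no stub, crux or summit is settled here; `VP ≠ VNP` untouched. [folklore]
-/

namespace Summit.ValiantsHypothesis.ValiantsHypothesis.Theorems.GeneratorObstructions.PowGenDegreeQP

-- `Summit.ValiantsHypothesis.ValiantsHypothesis.…` is the tree's mandated single-conjunct layout.
set_option linter.dupNamespace false

section PiFiberwise

variable {P Γ : Type*} (g : P → Γ) (A : P → Type*)

/-- Restricting a tuple to the classes of a partition is an equivalence. [folklore] -/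
def piFiberwiseEquiv : ((p : P) → A p) ≃ ((γ : Γ) → (p : {p : P // g p = γ}) → A p) where
  toFun ρ := fun _ p => ρ p.1
  invFun Y := fun p => Y (g p) ⟨p, rfl⟩
  left_inv ρ := rfl
  right_inv Y := by
    funext γ p
    obtain ⟨p, hp⟩ := p
    subst hp
    rfl

/-- Unfolding `piFiberwiseEquiv`. [folklore] -/
@[simp] theorem piFiberwiseEquiv_apply (ρ : (p : P) → A p) (γ : Γ) (p : {p : P // g p = γ}) :
    piFiberwiseEquiv g A ρ γ p = ρ p.1 := rfl

/-- **Fubini over a partition**: `Σ_ρ ∏_γ F γ (ρ|γ) = ∏_γ Σ_{y : tuples on the class γ} F γ y`.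
[folklore] -/
theorem sum_pi_prod_fiberwise [Fintype P] [DecidableEq P] [Fintype Γ] [DecidableEq Γ]
    [∀ p, Fintype (A p)] [∀ p, DecidableEq (A p)] {R : Type*} [CommSemiring R]
    (F : (γ : Γ) → ((p : {p : P // g p = γ}) → A p) → R) :
    (∑ ρ : (p : P) → A p, ∏ γ, F γ (fun p => ρ p.1)) =
      ∏ γ, ∑ y : (p : {p : P // g p = γ}) → A p, F γ y := by
  classical
  rw [Fintype.prod_sum]
  exact Fintype.sum_equiv (piFiberwiseEquiv g A) _ _ (fun ρ => rfl)

end PiFiberwise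

end Summit.ValiantsHypothesis.ValiantsHypothesis.Theorems.GeneratorObstructions.PowGenDegreeQP
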